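import Mathlib.LinearAlgebra.Isomorphisms
import Mathlib.LinearAlgebra.Dimension.FreeAndStrongRankCondition
import Mathlib.NumberTheory.Padics.RingHoms
import Mathlib.RingTheory.FiniteType
import Mathlib.RingTheory.LocalRing.Module
import HarnessLib

/-!
# The Lie-algebra game of Česnavičius (2018), §2, in abstract form

Topic `NumberTheory/EllipticCurves`; a proofs-only companion (theorems only: no definition, no
named fact, nothing restated; D-0026) of `ModularCurve.lean` and of
`ModularCurveManinSemistablePrimewiseProofs.lean`, written by the seat of the named fact
`ModularParametrizationData.abs_maninConstant_eq_one_of_isSemistable` (Česnavičius 2018,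
Thm. 1.2: the Manin constant `c_π` of a new elliptic optimal quotient `π : J₀(n) ↠ E` has
`ord_p(c_π) = 0` for every prime `p` with `p² ∤ n`; in particular `c = ±1` for semistable `E`).

The earlier companions reduced that fact, with all glue proved, to Česnavičius's theorem *as
printed*, prime by prime (`…_of_primewise`, `…_iff_primewise`). What is not in the tree is the
proof of the printed theorem, K. Česnavičius, *The Manin constant in the semistable case*,
Compositio Math. 154 (2018), §2: it is a short piece of commutative algebra — the "Lie-algebra
game" — played on objects Mathlib does not have (the Néron models `𝓙`, `𝓔` over `ℤ_p` of
`J₀(n)` and `E`, their Lie algebras as modules over the Hecke algebra `𝕋`, the Deligne–Rapoport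
model of `X₀(n)` and Grothendieck duality on it, multiplicity one modulo `p`). This file proves
**the commutative algebra of §2 for abstract modules**, in the order of the source, so that the
printed proof is mirrored down to its geometric inputs; each statement records the dictionary.

## Dictionary (source §2 ⟶ this file)

Fix a prime `p`, `R = ℤ_p`; `M = Lie(𝓙)_{ℤ_p}` (a `𝕋`-module, finite free over `ℤ_p`),
`L = Lie(𝓔)_{ℤ_p} ≅ ℤ_p`, `π = Lie(π) : M → L`, `ι = Lie(π^∨) : L → M` with `π ∘ ι = deg_f`
(`π ∘ π^∨ = deg_f` on `E`), `A = M[e_f]`, `B = M[e_f^⊥]` (the parts cut out integrally by the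
idempotents `e_f`, `e_f^⊥ = 1 - e_f` of `𝕋_ℚ`), `cong_M = M/(M[e_f] + M[e_f^⊥])` (the
congruence module of §2, Definition before the lemma `deg_f ∣ #cong_𝕋`).

* `ker_eq_of_saturated` — `ker Lie(π) = M[e_f^⊥]`: `B ≤ ker π`, `π` injective on `A` ("the
  injection `Lie(π) : Lie(𝓙)[e_f] ↪ Lie(𝓔)`"), `B` saturated and `M = A ⊕ B` rationally give
  `ker π = B`, so that `cong_M = M ⧸ (A ⊔ ker π)` below.
* `nonempty_quotientSupKer_equiv`, `card_quotientSupKer_mul_card_quotient_range`,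
  `range_smul_le_map`, `card_quotient_range_smul_eq`, `card_quotientSupKer_dvd` — the display
  (Lie-game) in the proof of the lemma `ord_p(#cong) = ord_p(deg_f)` (its inequality "`≤`"):
  `cong_M ≅ π(M)/π(M[e_f])`, `deg_f · L ⊆ π(M[e_f]) ⊆ π(M) ⊆ L`, hence
  `#(L/deg_f L) = #(π(M[e_f])/deg_f L) · #cong_M · #(L/π(M))` and `#cong_M ∣ #(L/deg_f L)`.
* `surjective_of_card_quotient_range_smul_dvd` — first sentence of the proof of the `Γ₀(n)`-case
  of Thm. 1.2 (Thm. "Manin-sst" of §2): if conversely `#(L/deg_f L) ∣ #cong_M` (this is the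
  inequality "`≥`", which the source gets from the lemma "`Lie(𝓙) ⊗ 𝕋_𝔪` is free of rank one"
  — multiplicity one — and from `deg_f ∣ #cong_𝕋`, Ribet's theorem, in the tree the named fact
  `modularDegree_dvd_congruenceNumber`), then `Lie(π) : Lie(𝓙) → Lie(𝓔)` is **surjective**.
* `isUnit_of_dual_comp_eq_smul`, `not_dvd_of_isUnit_intCast`, `not_dvd_of_lieGame` — rest of
  that proof: with `ω = ω_E` a Néron differential (a generator of `Lie(𝓔)^*`), `f ∈ Lie(𝓙)^* =
  H⁰(𝓙_{ℤ_p}, Ω¹)` the newform and `π^*(ω_E) = c_π · f`, `c_π ∈ ℤ` (Edixhoven 1991, Prop. 2),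
  surjectivity of `Lie(π)` makes `c_π` a unit of `ℤ_p`, i.e. `p ∤ c_π`. (The source passes through
  "the cokernel of `π^*` on `H⁰(Ω¹)` is torsion free"; evaluating `ω ∘ π = c f` at a preimage of a
  vector on which `ω = 1` is a shorter road to the same conclusion.)
* `not_dvd_of_dvd_of_not_dvd` — the last step (Thm. 1.2 for `Γ₁(n) ⊂ H ⊂ Γ₀(n)` from the
  `Γ₀(n)`-case and the lemma `c_π' = c_π · #Ker(e)`): `c_π ∣ c_π'`, `p ∤ c_π'` ⇒ `p ∤ c_π`.
* `card_quotient_range_smul_natCast`, `not_dvd_of_lieGame_padicInt` — the same over Mathlib's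
  `R = ℤ_[p]` with `L = ℤ_[p]` (`Lie(𝓔)_{ℤ_p}` with coordinate `ω_E`): `#(ℤ_p/deg_f ℤ_p) =
  p^{ord_p(deg_f)}`, so the hypothesis reads `p^{ord_p(deg_f)} ∣ #cong_M`, i.e.
  `ord_p(deg_f) ≤ ord_p(#cong_M)`, verbatim the inequality the source feeds in, and the conclusion
  is `p ∤ c_π`, i.e. `ord_p(c_π) = 0`, verbatim the printed one.
* `exists_surjective_toSpanSingleton`, `nonempty_linearEquiv_of_finrank_le_one` — the algebra
  of the lemma "`H¹(X₀(n)_{ℤ_p}, 𝒪) ⊗ 𝕋_𝔪` is free of rank one" of §2, implication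
  (multiplicity one for differentials at `𝔪`) ⇒ (freeness): over the local ring `T = 𝕋_𝔪`, if
  `H ⊗ T/𝔪` has dimension `≤ 1` (duality with `H⁰(X₀(n)_{𝔽_p}, Ω)[𝔪]`, of dimension one) then
  Nakayama gives `s : T ↠ H`, and if `T` and `H` are abstractly isomorphic finite `ℤ_p`-modules
  (both are `p`-torsion free of the same `ℤ_p`-rank, `H¹(X₀(n)_{ℚ̄_p})` being free of rank one
  over `𝕋_{ℚ̄_p}`, Diamond–Darmon–Taylor 1.34) then `s` is injective (Orzech/Vasconcelos), so
  `H ≅ T`.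

## What is NOT here

Nothing in this file mentions modular curves: the geometric inputs of §2 — the Néron models and
their Lie algebras with `𝕋`-action, `X₀(n)_{ℤ_p}` semistable for `p² ∤ n` (Deligne–Rapoport) with
`Pic⁰ = 𝓙⁰` (Raynaud, BLR 9.7/2), Grothendieck–Serre duality `H¹(X, 𝒪) = H⁰(X, Ω)^*`,
multiplicity one modulo `p` (Agashe–Ribet–Stein 2012, Lemma 5.20; Mazur, Wiles), the
`q`-expansion principle putting `f` in `H⁰(𝓙_{ℤ_p}, Ω¹)`, and Edixhoven's `c_π ∈ ℤ` — have no
home in Mathlib or in the tree yet, and are **not** introduced as named facts (D-0026). When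
they exist, `not_dvd_of_lieGame` instantiated with the dictionary above is the hypothesis `h12`
of `ModularParametrizationData.abs_maninConstant_eq_one_of_isSemistable_of_primewise`.

## References

* K. Česnavičius, *The Manin constant in the semistable case*, Compositio Math. 154 (2018),
  1889–1920, §2 (read: author's version arXiv:1703.02951v3, §2). [Cesnavicius2018]
* A. Agashe, K. A. Ribet, W. A. Stein, *The modular degree, congruence primes, and multiplicity
  one* (2012), Thm. 2.1 and Lemma 5.20. [AgasheRibetStein2012]
-/

namespace Literature.NumberTheory.EllipticCurves.ModularForms.LieGame

open Function

variable {R : Type*} [CommRing R] {M L : Type*} [AddCommGroup M] [Module R M] [AddCommGroup L]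
  [Module R L]

/-! ### `ker Lie(π) = Lie(𝓙)[e_f^⊥]` -/

/-- **`ker Lie(π) = M[e_f^⊥]`.** Let `π : M → L` be linear, `A, B ≤ M` with `B ≤ ker π`, `π`
injective on `A` (`A ⊓ ker π = ⊥`), `B` saturated for a set of scalars `S`
(`s • m ∈ B ⇒ m ∈ B` for `s ∈ S`) and `M = A ⊕ B` up to `S` (`∀ m, ∃ s ∈ S, s • m ∈ A ⊔ B`).
Then `ker π = B`. In Česnavičius 2018, §2: `M = Lie(𝓙)`, `A = M[e_f]`, `B = M[e_f^⊥]` (saturated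
by definition, `M[e] = M ∩ e M_ℚ`), `S = ℤ ∖ {0}`, and `π = Lie(π)` kills the `e_f^⊥`-part and is
injective on `M[e_f]` ("the injection `Lie(𝓙)[e_f] ↪ Lie(𝓔)`" of the display (Lie-game)).
[cite: Cesnavicius2018, §2 (proof of Thm. 1.2)] -/
theorem ker_eq_of_saturated (π : M →ₗ[R] L) {A B : Submodule R M} {S : Set R}
    (hB : B ≤ LinearMap.ker π) (hA : A ⊓ LinearMap.ker π = ⊥)
    (hsat : ∀ s ∈ S, ∀ m : M, s • m ∈ B → m ∈ B)
    (hrat : ∀ m : M, ∃ s ∈ S, s • m ∈ A ⊔ B) : LinearMap.ker π = B := by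
  refine le_antisymm (fun m hm ↦ ?_) hB
  obtain ⟨s, hs, hsm⟩ := hrat m
  obtain ⟨a, ha, b, hb, hab⟩ := Submodule.mem_sup.mp hsm
  have hπa : π a = 0 := by
    have h := congrArg π hab
    rw [map_add, map_smul, LinearMap.mem_ker.mp hm, smul_zero, LinearMap.mem_ker.mp (hB hb),
      add_zero] at h
    exact h
  have ha0 : a = 0 := by
    have : a ∈ A ⊓ LinearMap.ker π := ⟨ha, LinearMap.mem_ker.mpr hπa⟩
    rwa [hA, Submodule.mem_bot] at this
  refine hsat s hs m ?_
  rw [← hab, ha0, zero_add]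
  exact hb

/-! ### The congruence module of `Lie(𝓙)` inside `Lie(𝓔)`: the display (Lie-game) -/

section CongruenceModule

variable (π : M →ₗ[R] L) (A : Submodule R M)

/-- The kernel of `M → L → L/π(A)` is `A ⊔ ker π`. [folklore] -/
theorem ker_mkQ_comp : LinearMap.ker ((A.map π).mkQ ∘ₗ π) = A ⊔ LinearMap.ker π := by
  rw [LinearMap.ker_comp, Submodule.ker_mkQ, Submodule.comap_map_eq]

/-- The image of `M → L → L/π(A)` is `π(M)/π(A)`. [folklore] -/
theorem range_mkQ_comp :
    LinearMap.range ((A.map π).mkQ ∘ₗ π) = (LinearMap.range π).map (A.map π).mkQ :=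
  LinearMap.range_comp _ _

/-- **`cong_M ≅ π(M)/π(M[e_f])`.** For `π : M → L` and `A ≤ M`, the congruence module
`M ⧸ (A ⊔ ker π)` (`= M/(M[e_f] + M[e_f^⊥])` in the dictionary, `ker_eq_of_saturated`) is
isomorphic to `π(M)/π(A) ≤ L/π(A)`: the first isomorphism theorem for `M → L/π(A)`. This is the
identification behind the display (Lie-game) of Česnavičius 2018, §2 (proof of the lemma
`ord_p(#cong) = ord_p(deg_f)`). [cite: Cesnavicius2018, §2 (proof of Thm. 1.2)] -/
theorem nonempty_quotientSupKer_equiv :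
    Nonempty ((M ⧸ (A ⊔ LinearMap.ker π)) ≃ₗ[R] ↥((LinearMap.range π).map (A.map π).mkQ)) :=
  ⟨(Submodule.quotEquivOfEq _ _ (ker_mkQ_comp π A).symm).trans
    ((LinearMap.quotKerEquivRange _).trans (LinearEquiv.ofEq _ _ (range_mkQ_comp π A)))⟩

/-- `#cong_M = #(π(M)/π(A))`. [cite: Cesnavicius2018, §2 (proof of Thm. 1.2)] -/
theorem card_quotientSupKer_eq :
    Nat.card (M ⧸ (A ⊔ LinearMap.ker π)) =
      Nat.card ↥((LinearMap.range π).map (A.map π).mkQ) :=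
  Nat.card_congr (nonempty_quotientSupKer_equiv π A).some.toEquiv

/-- **Tower `π(A) ≤ π(M) ≤ L`:** `#cong_M · #(L/π(M)) = #(L/π(A))`.
[cite: Cesnavicius2018, §2 (proof of Thm. 1.2)] -/
theorem card_quotientSupKer_mul_card_quotient_range :
    Nat.card (M ⧸ (A ⊔ LinearMap.ker π)) * Nat.card (L ⧸ LinearMap.range π) =
      Nat.card (L ⧸ A.map π) := by
  rw [card_quotientSupKer_eq]
  exact Submodule.card_quotient_mul_card_quotient _ _ LinearMap.map_le_range

variable (ι : L →ₗ[R] M) (d : R)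

/-- **`deg_f · Lie(𝓔) ⊆ Lie(π)(Lie(𝓙)[e_f])`:** if `π ∘ ι = d` and `ι(L) ≤ A` then
`d L ≤ π(A)`. In the dictionary `ι = Lie(π^∨)`, `π ∘ π^∨ = deg_f`, and `π^∨(E) ⊆ J` lies in the
`f`-part. [cite: Cesnavicius2018, §2 (proof of Thm. 1.2)] -/
theorem range_smul_le_map (hπι : π ∘ₗ ι = d • LinearMap.id) (hι : LinearMap.range ι ≤ A) :
    LinearMap.range (d • (LinearMap.id : L →ₗ[R] L)) ≤ A.map π := by
  rintro x ⟨y, rfl⟩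
  refine ⟨ι y, hι (LinearMap.mem_range_self ι y), ?_⟩
  simpa using LinearMap.congr_fun hπι y

/-- **The display (Lie-game), as an identity of orders.** With `d L ≤ π(A) ≤ π(M) ≤ L`:
`#(L/dL) = #(π(A)/dL) · (#cong_M · #(L/π(M)))`. (`Nat.card` is `0` on infinite types, so this
holds with no finiteness assumption.) [cite: Cesnavicius2018, §2 (proof of Thm. 1.2)] -/
theorem card_quotient_range_smul_eq (hπι : π ∘ₗ ι = d • LinearMap.id)
    (hι : LinearMap.range ι ≤ A) :
    Nat.card (L ⧸ LinearMap.range (d • (LinearMap.id : L →ₗ[R] L))) =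
      Nat.card ↥((A.map π).map (LinearMap.range (d • (LinearMap.id : L →ₗ[R] L))).mkQ) *
        (Nat.card (M ⧸ (A ⊔ LinearMap.ker π)) * Nat.card (L ⧸ LinearMap.range π)) := by
  rw [card_quotientSupKer_mul_card_quotient_range,
    Submodule.card_quotient_mul_card_quotient _ _ (range_smul_le_map π A ι d hπι hι)]

/-- **Lemma `ord_p(#cong) = ord_p(deg_f)`, inequality "`≤`"** (Česnavičius 2018, §2, the
converse inequality in the proof of that lemma, via (Lie-game)): `#cong_M ∣ #(L/dL)`; with
`L = Lie(𝓔) ≅ ℤ_p` and `d = deg_f` the right-hand side is `p^{ord_p(deg_f)}`.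
[cite: Cesnavicius2018, §2 (proof of Thm. 1.2)] -/
theorem card_quotientSupKer_dvd (hπι : π ∘ₗ ι = d • LinearMap.id) (hι : LinearMap.range ι ≤ A) :
    Nat.card (M ⧸ (A ⊔ LinearMap.ker π)) ∣
      Nat.card (L ⧸ LinearMap.range (d • (LinearMap.id : L →ₗ[R] L))) := by
  rw [card_quotient_range_smul_eq π A ι d hπι hι]
  exact dvd_mul_of_dvd_right (dvd_mul_right _ _) _

/-- **`Lie(π) : Lie(𝓙) → Lie(𝓔)` is surjective** (Česnavičius 2018, §2, first sentence of the
proof of the `Γ₀(n)`-case of Thm. 1.2: "the lemma implies that the second injection in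
(Lie-game) is an isomorphism on `p`-primary parts, to the effect that `Lie(𝓙)_{ℤ_p} → Lie(𝓔)_{ℤ_p}`
is surjective"). Abstractly: if `π ∘ ι = d`, `ι(L) ≤ A`, `L/dL` is finite and
`#(L/dL) ∣ #cong_M` — the inequality "`≥`" of the lemma `ord_p(#cong) = ord_p(deg_f)`, which the
source obtains from freeness of `Lie(𝓙) ⊗ 𝕋_𝔪` (multiplicity one) and `deg_f ∣ #cong_𝕋` (Ribet;
Agashe–Ribet–Stein 2012, Thm. 2.1) — then `π` is onto: in the identity
`#(L/dL) = #(π(A)/dL) · #cong_M · #(L/π(M))` the outer factors must be `1`.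
[cite: Cesnavicius2018, §2 (proof of Thm. 1.2)] -/
theorem surjective_of_card_quotient_range_smul_dvd (hπι : π ∘ₗ ι = d • LinearMap.id)
    (hι : LinearMap.range ι ≤ A)
    [Finite (L ⧸ LinearMap.range (d • (LinearMap.id : L →ₗ[R] L)))]
    (h : Nat.card (L ⧸ LinearMap.range (d • (LinearMap.id : L →ₗ[R] L))) ∣
      Nat.card (M ⧸ (A ⊔ LinearMap.ker π))) :
    Function.Surjective π := by
  have hD : Nat.card (L ⧸ LinearMap.range (d • (LinearMap.id : L →ₗ[R] L))) ≠ 0 :=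
    Nat.card_pos.ne'
  have hprod := card_quotient_range_smul_eq π A ι d hπι hι
  obtain ⟨t, ht⟩ := h
  have hC : Nat.card (M ⧸ (A ⊔ LinearMap.ker π)) ≠ 0 := by
    intro hC
    apply hD
    rw [hprod, hC, zero_mul, mul_zero]
  have h1 : Nat.card ↥((A.map π).map (LinearMap.range (d • (LinearMap.id : L →ₗ[R] L))).mkQ) *
      Nat.card (L ⧸ LinearMap.range π) * t = 1 := by
    refine (Nat.eq_of_mul_eq_mul_left (Nat.pos_of_ne_zero hC) ?_).symm
    calc Nat.card (M ⧸ (A ⊔ LinearMap.ker π)) * 1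
        = Nat.card (L ⧸ LinearMap.range (d • (LinearMap.id : L →ₗ[R] L))) * t := by
          rw [mul_one]; exact ht
      _ = _ := by rw [hprod]; ring
  have hZ : Nat.card (L ⧸ LinearMap.range π) = 1 :=
    Nat.eq_one_of_mul_eq_one_left (Nat.eq_one_of_mul_eq_one_right h1)
  have hsub : Subsingleton (L ⧸ LinearMap.range π) := (Nat.card_eq_one_iff_unique.mp hZ).1
  rw [← LinearMap.range_eq_top]
  exact Submodule.Quotient.subsingleton_iff.mp hsub

end CongruenceModule

/-! ### Primitivity of `π^*(ω_E) = c_π · f` and `ord_p(c_π) = 0` -/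

/-- **A surjection pulls a unimodular form back to a unimodular form.** If `π : M → L` is onto,
`ω : L → R` is onto (e.g. a generator of the dual of `L ≅ R`: a Néron differential `ω_E` on
`Lie(𝓔)`), and `ω ∘ π = c • f` for some form `f` on `M`, then `c` is a unit. In Česnavičius
2018, §2 (proof of the `Γ₀(n)`-case of Thm. 1.2): `Lie(π)` onto ⇒ `π^*(ω_E)` is not divisible by
`p` in `H⁰(𝓙_{ℤ_p}, Ω¹) = Lie(𝓙)^*`; as `π^*(ω_E) = c_π · f` with `f ∈ H⁰(𝓙_{ℤ_p}, Ω¹)`,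
`c_π ∈ ℤ_p^×`. (The source argues through torsion-freeness of the cokernel of `π^*`; evaluating at
a preimage of a vector with `ω = 1` is shorter.) [cite: Cesnavicius2018, §2 (proof of Thm. 1.2)] -/
theorem isUnit_of_dual_comp_eq_smul {π : M →ₗ[R] L} (hπ : Function.Surjective π)
    {ω : L →ₗ[R] R} (hω : Function.Surjective ω) {f : M →ₗ[R] R} {c : R}
    (h : ω ∘ₗ π = c • f) : IsUnit c := by
  obtain ⟨l, hl⟩ := hω 1
  obtain ⟨m, rfl⟩ := hπ l
  have h1 : c * f m = 1 := by
    have := LinearMap.congr_fun h m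
    rw [LinearMap.comp_apply, hl, LinearMap.smul_apply, smul_eq_mul] at this
    exact this.symm
  exact IsUnit.of_mul_eq_one (f m) h1

/-- **`c ∈ ℤ` a unit in `R`, `p` not a unit in `R` ⇒ `p ∤ c`** (with `R = ℤ_p`: `ord_p(c) = 0`;
the integrality `c_π ∈ ℤ` is Edixhoven 1991, Prop. 2, an input of the source). [folklore] -/
theorem not_dvd_of_isUnit_intCast {c : ℤ} {p : ℕ} (hc : IsUnit ((c : ℤ) : R))
    (hp : ¬IsUnit ((p : ℕ) : R)) : ¬(p : ℤ) ∣ c := by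
  rintro ⟨k, rfl⟩
  refine hp ?_
  rw [Int.cast_mul, Int.cast_natCast] at hc
  exact isUnit_of_mul_isUnit_left hc

/-- **The `Γ₀(n)`-case of Česnavičius's Thm. 1.2 (Thm. "Manin-sst" of §2), its commutative
algebra in one statement.** Data (dictionary in the module docstring): `π = Lie(π) : M → L`,
`ι = Lie(π^∨)` with `π ∘ ι = d = deg_f` and `ι(L) ≤ A = M[e_f]`; `L/dL` finite (`L ≅ ℤ_p`,
`deg_f ≠ 0`); the inequality `#(L/dL) ∣ #(M ⧸ (A ⊔ ker π))` (multiplicity one and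
`deg_f ∣ #cong_𝕋`); `ω = ω_E` onto `R`; `f` the newform as a form on `M = Lie(𝓙)`
(`q`-expansion principle); `ω ∘ π = c • f` with `c = c_π ∈ ℤ` (definition of the Manin constant and
Edixhoven's integrality); `p` not a unit of `R = ℤ_p`. Conclusion: `p ∤ c_π`, i.e.
`ord_p(c_π) = 0`. Instantiated on Néron models this is the hypothesis `h12` of
`ModularParametrizationData.abs_maninConstant_eq_one_of_isSemistable_of_primewise`.
[cite: Cesnavicius2018, Thm. 1.2 (case H = Γ₀(n)), proof in §2] -/
theorem not_dvd_of_lieGame (π : M →ₗ[R] L) (A : Submodule R M) (ι : L →ₗ[R] M) (d : R)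
    (hπι : π ∘ₗ ι = d • LinearMap.id) (hι : LinearMap.range ι ≤ A)
    [Finite (L ⧸ LinearMap.range (d • (LinearMap.id : L →ₗ[R] L)))]
    (hcong : Nat.card (L ⧸ LinearMap.range (d • (LinearMap.id : L →ₗ[R] L))) ∣
      Nat.card (M ⧸ (A ⊔ LinearMap.ker π)))
    {ω : L →ₗ[R] R} (hω : Function.Surjective ω) {f : M →ₗ[R] R} {c : ℤ}
    (hcf : ω ∘ₗ π = ((c : ℤ) : R) • f) {p : ℕ} (hp : ¬IsUnit ((p : ℕ) : R)) : ¬(p : ℤ) ∣ c :=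
  not_dvd_of_isUnit_intCast
    (isUnit_of_dual_comp_eq_smul (surjective_of_card_quotient_range_smul_dvd π A ι d hπι hι hcong)
      hω hcf) hp

/-- **From `Γ₀(n)` to `Γ₁(n) ⊂ H ⊂ Γ₀(n)`** (Česnavičius 2018, proof of Thm. 1.2 from its
`Γ₀(n)`-case and the lemma `c_π' = c_π · #Ker(e)`): the Manin constant `c = c_π` of the
`J_H`-optimal quotient divides that of the `J₀(n)`-optimal one, `c' = c_π'`, so `p ∤ c'` gives
`p ∤ c`. [cite: Cesnavicius2018, Thm. 1.2 (proof)] -/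
theorem not_dvd_of_dvd_of_not_dvd {c c' : ℤ} {p : ℕ} (hcc' : c ∣ c') (h' : ¬(p : ℤ) ∣ c') :
    ¬(p : ℤ) ∣ c :=
  fun h ↦ h' (h.trans hcc')

/-! ### The same over `ℤ_p`: `ord_p(deg_f) ≤ ord_p(#cong) ⇒ ord_p(c_π) = 0` -/

section PadicInt

open PadicInt

variable {p : ℕ} [hp : Fact p.Prime]

/-- `ord_p` of a natural number computed in `ℤ_p`: the valuation of `n ∈ ℤ_[p]` is
`padicValNat p n`. [folklore] -/
theorem valuation_natCast_eq (n : ℕ) : (n : ℤ_[p]).valuation = padicValNat p n := by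
  have h := PadicInt.valuation_coe (n : ℤ_[p])
  rw [PadicInt.coe_natCast, Padic.valuation_natCast] at h
  exact_mod_cast h.symm

/-- `n ℤ_p = p^{ord_p(n)} ℤ_p` for `n ≠ 0`. [folklore] -/
theorem range_smul_natCast_eq_span {n : ℕ} (hn : n ≠ 0) :
    LinearMap.range ((n : ℤ_[p]) • (LinearMap.id : ℤ_[p] →ₗ[ℤ_[p]] ℤ_[p])) =
      Ideal.span {(p : ℤ_[p]) ^ padicValNat p n} := by
  have hn' : (n : ℤ_[p]) ≠ 0 := by exact_mod_cast hn
  have h1 : LinearMap.range ((n : ℤ_[p]) • (LinearMap.id : ℤ_[p] →ₗ[ℤ_[p]] ℤ_[p])) =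
      Ideal.span {(n : ℤ_[p])} := by
    ext x
    simp only [LinearMap.mem_range, LinearMap.smul_apply, LinearMap.id_apply, smul_eq_mul,
      Ideal.mem_span_singleton']
    constructor <;> rintro ⟨y, rfl⟩ <;> exact ⟨y, mul_comm _ _⟩
  rw [h1, Ideal.span_singleton_eq_span_singleton, ← valuation_natCast_eq n]
  refine ⟨(unitCoeff hn')⁻¹, ?_⟩
  have hs := unitCoeff_spec hn'
  calc (n : ℤ_[p]) * ↑(unitCoeff hn')⁻¹
      = (unitCoeff hn' : ℤ_[p]) * (p : ℤ_[p]) ^ (n : ℤ_[p]).valuation * ↑(unitCoeff hn')⁻¹ := by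
        rw [← hs]
    _ = (p : ℤ_[p]) ^ (n : ℤ_[p]).valuation := by
        rw [mul_comm ((unitCoeff hn' : ℤ_[p]ˣ) : ℤ_[p]) _, Units.mul_inv_cancel_right]

/-- **`#(ℤ_p / n ℤ_p) = p^{ord_p(n)}`** for `n ≠ 0` (so that, with `L = Lie(𝓔)_{ℤ_p} ≅ ℤ_p` and
`n = deg_f`, the order `#(L/deg_f L)` of the Lie game is `p^{ord_p(deg_f)}`). [folklore] -/
theorem card_quotient_range_smul_natCast {n : ℕ} (hn : n ≠ 0) :
    Nat.card (ℤ_[p] ⧸ LinearMap.range ((n : ℤ_[p]) • (LinearMap.id : ℤ_[p] →ₗ[ℤ_[p]] ℤ_[p]))) =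
      p ^ padicValNat p n :=
  calc Nat.card (ℤ_[p] ⧸ LinearMap.range ((n : ℤ_[p]) • (LinearMap.id : ℤ_[p] →ₗ[ℤ_[p]] ℤ_[p])))
      = Nat.card (ℤ_[p] ⧸ Ideal.span {(p : ℤ_[p]) ^ padicValNat p n}) :=
        Nat.card_congr (Submodule.quotEquivOfEq _ _ (range_smul_natCast_eq_span hn)).toEquiv
    _ = Nat.card (ZMod (p ^ padicValNat p n)) :=
        Nat.card_congr ((Ideal.quotEquivOfEq (PadicInt.ker_toZModPow _).symm).trans
          (RingHom.quotientKerEquivOfSurjective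
            (ZMod.ringHom_surjective (PadicInt.toZModPow _)))).toEquiv
    _ = p ^ padicValNat p n := Nat.card_zmod _

/-- **Česnavičius's Thm. 1.2, case `H = Γ₀(n)` (Thm. "Manin-sst" of §2), over `ℤ_p` as printed:**
`ord_p(deg_f) ≤ ord_p(#cong) ⇒ ord_p(c_π) = 0`. Dictionary: `M = Lie(𝓙)_{ℤ_p}`,
`π = ω_E ∘ Lie(π) : M → ℤ_p` (the Lie algebra `Lie(𝓔)_{ℤ_p}` in the coordinate given by a Néron
differential `ω_E`, so that `π` *is* the form `π^*(ω_E) ∈ H⁰(𝓙_{ℤ_p}, Ω¹) = M^*`),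
`ι = Lie(π^∨)`, `π ∘ ι = deg_f ≠ 0`, `ι(ℤ_p) ≤ A = M[e_f]`; `hcong : p^{ord_p(deg_f)} ∣ #cong_M`,
`cong_M = M ⧸ (A ⊔ ker π) = M/(M[e_f] + M[e_f^⊥])` — the inequality the source obtains from the
lemma "`Lie(𝓙) ⊗ 𝕋_𝔪` free of rank one" (multiplicity one: `#cong_{Lie(𝓙)} = p^{ord_p(#cong_𝕋)}`)
and from `deg_f ∣ #cong_𝕋` (Agashe–Ribet–Stein 2012, Thm. 2.1; the tree's
`modularDegree_dvd_congruenceNumber`); `π = c • f` with `f ∈ M^*` the newform (`q`-expansion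
principle) and `c = c_π ∈ ℤ` (Edixhoven 1991, Prop. 2). Conclusion `p ∤ c_π`. The geometric
inputs are hypotheses here because their objects are not in Mathlib; nothing is assumed about
modular curves. [cite: Cesnavicius2018, Thm. 1.2 (case H = Γ₀(n)), proof in §2] -/
theorem not_dvd_of_lieGame_padicInt {M : Type*} [AddCommGroup M] [Module ℤ_[p] M]
    (π : M →ₗ[ℤ_[p]] ℤ_[p]) (A : Submodule ℤ_[p] M) (ι : ℤ_[p] →ₗ[ℤ_[p]] M) {deg : ℕ}
    (hdeg : deg ≠ 0) (hπι : π ∘ₗ ι = (deg : ℤ_[p]) • LinearMap.id) (hι : LinearMap.range ι ≤ A)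
    (hcong : p ^ padicValNat p deg ∣ Nat.card (M ⧸ (A ⊔ LinearMap.ker π)))
    {f : M →ₗ[ℤ_[p]] ℤ_[p]} {c : ℤ} (hcf : π = ((c : ℤ) : ℤ_[p]) • f) : ¬(p : ℤ) ∣ c := by
  haveI : Finite (ℤ_[p] ⧸
      LinearMap.range ((deg : ℤ_[p]) • (LinearMap.id : ℤ_[p] →ₗ[ℤ_[p]] ℤ_[p]))) :=
    Nat.finite_of_card_ne_zero
      (by rw [card_quotient_range_smul_natCast hdeg]; exact pow_ne_zero _ hp.out.ne_zero)
  refine not_dvd_of_lieGame π A ι (deg : ℤ_[p]) hπι hι ?_ (ω := LinearMap.id) (fun x ↦ ⟨x, rfl⟩)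
    (f := f) ?_ PadicInt.irreducible_p.not_isUnit
  · rwa [card_quotient_range_smul_natCast hdeg]
  · rw [LinearMap.id_comp]; exact hcf

end PadicInt

/-! ### The lemma "`H¹ ⊗ 𝕋_𝔪` is free of rank one": multiplicity one ⇒ freeness -/

section H1Free

open IsLocalRing TensorProduct

variable {T : Type*} [CommRing T] [IsLocalRing T] {H : Type*} [AddCommGroup H] [Module T H]
  [Module.Finite T H]

/-- **Nakayama: a finite module over a local ring whose fibre has dimension `≤ 1` is cyclic.**
If `dim_{T/𝔪} (T/𝔪 ⊗_T H) ≤ 1` then `H = T x` for some `x`, i.e. `T → H, t ↦ t x` is onto. In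
Česnavičius 2018, §2 (proof of the lemma "`H¹(X₀(n)_{ℤ_p}, 𝒪) ⊗ 𝕋_𝔪` is free of rank one",
(iii) ⇒ (ii)): `T = 𝕋_𝔪`, `H = H¹(X₀(n)_{ℤ_p}, 𝒪) ⊗_𝕋 𝕋_𝔪`, whose fibre `H ⊗ 𝕋/𝔪` is the
dual of `H⁰(X₀(n)_{𝔽_p}, Ω)[𝔪]`, of dimension one by multiplicity one; "the Nakayama lemma
supplies a `𝕋_𝔪`-module surjection `s : 𝕋_𝔪 ↠ H¹(X₀(n)_{ℤ_p}, 𝒪) ⊗_𝕋 𝕋_𝔪`".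
[cite: Cesnavicius2018, §2 (proof of Thm. 1.2)] -/
theorem exists_surjective_toSpanSingleton
    (h1 : Module.finrank (ResidueField T) (ResidueField T ⊗[T] H) ≤ 1) :
    ∃ x : H, Function.Surjective (LinearMap.toSpanSingleton T H x) := by
  obtain ⟨v, hv⟩ := finrank_le_one_iff.mp h1
  obtain ⟨x, rfl⟩ :=
    TensorProduct.mk_surjective T H (ResidueField T) Ideal.Quotient.mk_surjective v
  refine ⟨x, ?_⟩
  rw [← LinearMap.range_eq_top, LinearMap.range_toSpanSingleton,
    ← IsLocalRing.map_tensorProduct_mk_eq_top, Submodule.map_span, Set.image_singleton, eq_top_iff]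
  rintro w -
  obtain ⟨c, rfl⟩ := hv w
  obtain ⟨t, rfl⟩ := IsLocalRing.residue_surjective c
  have : (IsLocalRing.residue T t) • ((TensorProduct.mk T (ResidueField T) H) 1 x) =
      t • ((TensorProduct.mk T (ResidueField T) H) 1 x) :=
    algebraMap_smul (ResidueField T) t _
  rw [this]
  exact Submodule.smul_mem _ t (Submodule.subset_span rfl)

variable {R₀ : Type*} [CommRing R₀] [Algebra R₀ T] [Module R₀ H] [IsScalarTower R₀ T H]

/-- **Multiplicity one ⇒ `H ≅ 𝕋_𝔪` free of rank one** (Česnavičius 2018, §2, the lemma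
"`H¹ ⊗ 𝕋_𝔪` is free of rank one", implication (iii) ⇒ (ii) ⇒ (i)). Abstractly: `T` a local
ring, finite over a base `R₀` (`𝕋_𝔪` over `ℤ_p`), `H` a finite `T`-module whose fibre
`H ⊗ T/𝔪` has dimension `≤ 1` (multiplicity one, through the duality
`H¹ ⊗ 𝕋/𝔪 = (H⁰(X₀(n)_{𝔽_p}, Ω)[𝔪])^*`), and `T ≅ H` as `R₀`-modules (source: "since
`H¹(X₀(n)_{ℚ̄_p})` is free of rank `1` as a `𝕋_{ℚ̄_p}`-module, the base change of `s` to `ℚ̄_p`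
is injective; since the source and the target of `s` are `p`-torsion free, `s` itself is
injective" — two finite free `ℤ_p`-modules of the same rank are isomorphic). Then the Nakayama
surjection `s : T ↠ H` is injective (a surjection onto a finite module that also receives an
injection from the source is injective: Orzech–Vasconcelos), so `H ≅ T` as `T`-modules.
[cite: Cesnavicius2018, §2 (proof of Thm. 1.2)] -/
theorem nonempty_linearEquiv_of_finrank_le_one [Module.Finite R₀ T]
    (h1 : Module.finrank (ResidueField T) (ResidueField T ⊗[T] H) ≤ 1)
    (hiso : Nonempty (T ≃ₗ[R₀] H)) : Nonempty (T ≃ₗ[T] H) := by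
  obtain ⟨x, hx⟩ := exists_surjective_toSpanSingleton h1
  obtain ⟨e⟩ := hiso
  haveI : Module.Finite R₀ H := Module.Finite.equiv e
  have hinj : Function.Injective (LinearMap.toSpanSingleton T H x) :=
    OrzechProperty.injective_of_surjective_of_injective (R := R₀) (M := H) e.toLinearMap
      ((LinearMap.toSpanSingleton T H x).restrictScalars R₀) e.injective hx
  exact ⟨LinearEquiv.ofBijective _ ⟨hinj, hx⟩⟩

end H1Free

end Literature.NumberTheory.EllipticCurves.ModularForms.LieGame
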